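import Summits.CriticalPhenomena.PercolationContinuityZ3.Theorems.PercNearOneGluingNoHeavyLowerTailCondCertCheck
import Summits.CriticalPhenomena.PercolationContinuityZ3.Theorems.PercNearOneGluingNoHeavyLowerTailCondCertRows
import Summits.CriticalPhenomena.PercolationContinuityZ3.Theorems.PercNearOneGluingNoHeavyLowerTailCertRowsGroupData
import HarnessLib

/-!
# `NoHeavyLowerTail` (stmt-CriticalPhenomena-4575) — `COND₃`/`KN13` certificate wrapper, part 1c: hypothesis × k-petal groups, FACTORED columns, factored `M₀`

Support file (prover prim-ineq-prove-1; `--supports stmt-CriticalPhenomena-4575`).  Bookkeeping definitions + soundness; no sorries.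
* `HRKSpec` — `(μ(D_hi) − μ(D_lo)) · (k-petal sunflower group)`, valid in sum given the group soundness and the hypothesis;
* `mulLin`, `mulFactors`, `evalF` — multiplying a term list by linear forms (masses = cell lists), normalising after each factor;
* `FCol` / `FColK` — a typed base (`HRBase` / `SFKSpec`) times a PRODUCT OF MASSES (higher-degree certificates: the multiplier is kept
  factored, never expanded into cell monomials); `FCol.sum_all`, `FColK.sum_all` — summed over the hash buckets, small ≤ large;
* `m0valF`, `qTermsF`, `evalT_qTermsF`, `m0valF_pos` — the factored part of the multiplier `M₀`;
* `FLin`, `FLin.sum_all` — hypothesis rows with factored multipliers.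
-/

noncomputable section

namespace Summit.CriticalPhenomena.PercolationContinuityZ3.Theorems

open MeasureTheory Set Filter Literature.Probability.Percolation
open Literature.Probability.LatticeModels (prodBernoulli)
open scoped Classical BigOperators Topology
open PatternCells CertCheck CertCells PatternSunflower

namespace CondCert

variable {n : ℕ}

/-! ## Hypothesis × k-petal sunflower groups -/

/-- A hypothesis×(k-petal sunflower) group: `(μ(D_hi) − μ(D_lo)) · (sunflower row) ≥ 0`. [folklore] -/
structure HRKSpec where
  /-- the hypothesis pair `(lo, hi)`: `μ(D_lo) ≤ μ(D_hi)` -/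
  hyp : Fin 5 × Fin 5
  /-- the k-petal sunflower base (carrying multiplier and weight) -/
  base : SFKSpec

/-- The rows: base rows times each cell of `D_hi`, reversed base rows times each cell of `D_lo`. [folklore] -/
def HRKSpec.rows (h : HRKSpec) : List Row :=
  (cellsOf (fD h.hyp.2)).flatMap (fun c => h.base.rows.map (rowWithCell c)) ++
    (cellsOf (fD h.hyp.1)).flatMap (fun c => h.base.rows.map fun r => rowWithCell c (rowRev r))

/-- A hypothesis×(k-petal sunflower) group holds in sum, given the soundness of k-petal groups and its hypothesis. [folklore] -/
theorem HRKSpec.rowSum (h : HRKSpec) (hv : h.base.valid = true) (hS : ∀ s : SFKSpec, s.valid = true → GroupHolds s.rows) (w : Sym2 (Fin n) → unitInterval) (v : Fin 5 → Fin n)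
    (hh : (prodBernoulli w).real ((fD h.hyp.1).set v) ≤ (prodBernoulli w).real ((fD h.hyp.2).set v)) :
    let x : ℕ → ℝ := fun m => (prodBernoulli w).real (Cell v m)
    (h.rows.map fun r => (r.wt : ℝ) * evalM x r.mult * (linEval x r.e1 * linEval x r.e2)).sum ≤
      (h.rows.map fun r => (r.wt : ℝ) * evalM x r.mult * (linEval x r.e3 * linEval x r.e4)).sum := by
  intro x
  have hB := hS h.base hv n w v
  set BS := (h.base.rows.map fun r => (r.wt : ℝ) * evalM x r.mult * (linEval x r.e1 * linEval x r.e2)).sum with hBS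
  set BL := (h.base.rows.map fun r => (r.wt : ℝ) * evalM x r.mult * (linEval x r.e3 * linEval x r.e4)).sum with hBL
  have hhypx : linEval x (cellsOf (fD h.hyp.1)) ≤ linEval x (cellsOf (fD h.hyp.2)) := by
    simpa only [x, ← measureReal_set_eq_linEval] using hh
  simp only [HRKSpec.rows, List.map_append, List.sum_append, sum_map_flatMap', sum_rowWithCell_small, sum_rowWithCell_large,
    sum_rowRevWithCell_small, sum_rowRevWithCell_large, sum_map_mul_const']
  change linEval x (cellsOf (fD h.hyp.2)) * BS + linEval x (cellsOf (fD h.hyp.1)) * BL ≤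
    linEval x (cellsOf (fD h.hyp.2)) * BL + linEval x (cellsOf (fD h.hyp.1)) * BS
  nlinarith [mul_le_mul_of_nonneg_left (sub_nonneg.2 hB) (sub_nonneg.2 hhypx)]

/-- Rows valid in sum over a list of hypothesis×(k-petal) groups. [folklore] -/
theorem HRKSpec.rowSum_all (specs : List HRKSpec) (hvalid : (specs.all fun h => h.base.valid) = true)
    (hS : specs ≠ [] → ∀ s : SFKSpec, s.valid = true → GroupHolds s.rows) (w : Sym2 (Fin n) → unitInterval) (v : Fin 5 → Fin n)
    (hh : ∀ h ∈ specs, (prodBernoulli w).real ((fD h.hyp.1).set v) ≤ (prodBernoulli w).real ((fD h.hyp.2).set v)) :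
    let x : ℕ → ℝ := fun m => (prodBernoulli w).real (Cell v m)
    ((specs.flatMap HRKSpec.rows).map fun r => (r.wt : ℝ) * evalM x r.mult * (linEval x r.e1 * linEval x r.e2)).sum ≤
      ((specs.flatMap HRKSpec.rows).map fun r => (r.wt : ℝ) * evalM x r.mult * (linEval x r.e3 * linEval x r.e4)).sum := by
  intro x
  induction specs with
  | nil => simp
  | cons s rest ih =>
    simp only [List.all_cons, Bool.and_eq_true] at hvalid
    have hS' := hS (List.cons_ne_nil _ _)
    rw [List.flatMap_cons, List.map_append, List.map_append, List.sum_append, List.sum_append]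
    exact add_le_add (HRKSpec.rowSum s hvalid.1 hS' w v (hh s (by simp)))
      (ih hvalid.2 (fun _ => hS') fun h hm => hh h (List.mem_cons_of_mem _ hm))

/-! ## Columns with FACTORED multipliers (products of masses = cell lists), for certificates of higher degree -/

/-- Multiply a term list by a linear form (cell list): every term `(m, c)` becomes `(m·x_i, c)` for `i ∈ e`. [folklore] -/
def mulLin (p : List Term) (e : List ℕ) : List Term := p.flatMap fun t => e.map fun i => (monoIns i t.1, t.2)

/-- The value of one term times a linear form. [folklore] -/
theorem evalT_map_monoIns (x : ℕ → ℝ) (t : Term) (e : List ℕ) :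
    evalT x (e.map fun i => (monoIns i t.1, t.2)) = (t.2 : ℝ) * evalM x t.1 * linEval x e := by
  induction e with
  | nil => simp [evalT, linEval]
  | cons i e' ih' =>
    rw [List.map_cons, evalT_cons, ih']
    simp only [evalM_monoIns, linEval, List.map_cons, List.sum_cons]
    ring

/-- The value of the product by a linear form. [folklore] -/
theorem evalT_mulLin (x : ℕ → ℝ) (p : List Term) (e : List ℕ) : evalT x (mulLin p e) = evalT x p * linEval x e := by
  unfold mulLin
  induction p with
  | nil => simp [evalT]
  | cons t l ih =>
    rw [List.flatMap_cons, evalT_append, ih, evalT_cons, evalT_map_monoIns]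
    ring

/-- Multiply by a product of linear forms, normalising after each factor (sizes stay bounded by the distinct monomials). [folklore] -/
def mulFactors (p : List Term) : List (List ℕ) → List Term
  | [] => p
  | e :: fs => mulFactors (normalize (mulLin p e)) fs

/-- Value of a product of linear forms. [folklore] -/
def evalF (x : ℕ → ℝ) (fs : List (List ℕ)) : ℝ := (fs.map (linEval x)).prod

/-- `evalF` is nonnegative at nonnegative points. [folklore] -/
theorem evalF_nonneg (x : ℕ → ℝ) (hx : ∀ i, 0 ≤ x i) (fs : List (List ℕ)) : 0 ≤ evalF x fs := by
  unfold evalF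
  apply List.prod_nonneg
  intro a ha
  obtain ⟨e, _, rfl⟩ := List.mem_map.1 ha
  unfold linEval
  exact List.sum_nonneg (fun b hb => by obtain ⟨i, _, rfl⟩ := List.mem_map.1 hb; exact hx i)

/-- The value after multiplying by the factors. [folklore] -/
theorem evalT_mulFactors (x : ℕ → ℝ) : ∀ (fs : List (List ℕ)) (p : List Term), evalT x (mulFactors p fs) = evalT x p * evalF x fs
  | [], p => by simp [mulFactors, evalF]
  | e :: fs, p => by
    rw [mulFactors, evalT_mulFactors x fs, evalT_normalize, evalT_mulLin]
    simp only [evalF, List.map_cons, List.prod_cons]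
    ring

/-- A column with a factored multiplier: a typed base (as for hypothesis×row groups) and a list of linear factors. [folklore] -/
structure FCol where
  /-- the base row / group -/
  base : HRBase
  /-- extra multiplier: a product of linear forms (cell lists), each nonnegative at a cell law -/
  factors : List (List ℕ)

/-- Side conditions of a factored column: those of its base. [folklore] -/
def FCol.valid (c : FCol) : Bool := c.base.valid

/-- The small-side terms of a factored column in bucket `b`. [folklore] -/
def FCol.smallB (nb b : ℕ) (c : FCol) : List Term :=
  (mulFactors (normalize (c.base.rows.flatMap fun r => pairTerms r.e1 r.e2 r.mult r.wt)) c.factors).filter fun t => bucket nb t == b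

/-- The large-side terms of a factored column in bucket `b`. [folklore] -/
def FCol.largeB (nb b : ℕ) (c : FCol) : List Term :=
  (mulFactors (normalize (c.base.rows.flatMap fun r => pairTerms r.e3 r.e4 r.mult r.wt)) c.factors).filter fun t => bucket nb t == b

/-- The small side of a factored column, summed over buckets, is `(Σ base small) · factors`. [folklore] -/
theorem FCol.sum_evalT_smallB (x : ℕ → ℝ) {nb : ℕ} (hnb : 0 < nb) (c : FCol) :
    ((List.range nb).map fun b => evalT x (c.smallB nb b)).sum =
      (c.base.rows.map fun r => (r.wt : ℝ) * evalM x r.mult * (linEval x r.e1 * linEval x r.e2)).sum * evalF x c.factors := by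
  have h := evalT_eq_sum_buckets x hnb (mulFactors (normalize (c.base.rows.flatMap fun r => pairTerms r.e1 r.e2 r.mult r.wt)) c.factors)
  simp only [FCol.smallB]
  rw [← h, evalT_mulFactors, evalT_normalize, evalT_flatMap]
  simp only [evalT_pairTerms]

/-- The large side of a factored column, summed over buckets, is `(Σ base large) · factors`. [folklore] -/
theorem FCol.sum_evalT_largeB (x : ℕ → ℝ) {nb : ℕ} (hnb : 0 < nb) (c : FCol) :
    ((List.range nb).map fun b => evalT x (c.largeB nb b)).sum =
      (c.base.rows.map fun r => (r.wt : ℝ) * evalM x r.mult * (linEval x r.e3 * linEval x r.e4)).sum * evalF x c.factors := by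
  have h := evalT_eq_sum_buckets x hnb (mulFactors (normalize (c.base.rows.flatMap fun r => pairTerms r.e3 r.e4 r.mult r.wt)) c.factors)
  simp only [FCol.largeB]
  rw [← h, evalT_mulFactors, evalT_normalize, evalT_flatMap]
  simp only [evalT_pairTerms]

/-- A valid factored column: small ≤ large after summing over buckets, at every cell law. [folklore] -/
theorem FCol.sum_small_le_large (c : FCol) (hc : c.valid = true) {nb : ℕ} (hnb : 0 < nb) (w : Sym2 (Fin n) → unitInterval)
    (v : Fin 5 → Fin n) :
    let x : ℕ → ℝ := fun m => (prodBernoulli w).real (Cell v m)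
    ((List.range nb).map fun b => evalT x (c.smallB nb b)).sum ≤ ((List.range nb).map fun b => evalT x (c.largeB nb b)).sum := by
  intro x
  have hx : ∀ i, 0 ≤ x i := fun _ => measureReal_nonneg
  rw [FCol.sum_evalT_smallB x hnb, FCol.sum_evalT_largeB x hnb]
  exact mul_le_mul_of_nonneg_right (HRBase.rowSum c.base hc w v) (evalF_nonneg x hx _)

/-- Swap a double sum: `Σ_{c} Σ_{b} f c b = Σ_{b} Σ_{c} f c b` for lists. [folklore] -/
theorem sum_map_sum_comm {α : Type*} (l : List α) (bs : List ℕ) (f : α → ℕ → ℝ) :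
    (l.map fun c => (bs.map fun b => f c b).sum).sum = (bs.map fun b => (l.map fun c => f c b).sum).sum := by
  induction l with
  | nil => simp
  | cons a t ih =>
    rw [List.map_cons, List.sum_cons, ih]
    have : (bs.map fun b => ((a :: t).map fun c => f c b).sum) = bs.map fun b => f a b + (t.map fun c => f c b).sum := by
      refine List.map_congr_left fun b _ => ?_
      rw [List.map_cons, List.sum_cons]
    rw [this, List.sum_map_add]

/-- **Factored columns hold in sum over buckets**: for valid columns, `Σ_b Σ_c small_b(c) ≤ Σ_b Σ_c large_b(c)`. [folklore] -/
theorem FCol.sum_all (cols : List FCol) (hvalid : (cols.all FCol.valid) = true) {nb : ℕ} (hnb : 0 < nb)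
    (w : Sym2 (Fin n) → unitInterval) (v : Fin 5 → Fin n) :
    let x : ℕ → ℝ := fun m => (prodBernoulli w).real (Cell v m)
    ((List.range nb).map fun b => (cols.map fun c => evalT x (c.smallB nb b)).sum).sum ≤
      ((List.range nb).map fun b => (cols.map fun c => evalT x (c.largeB nb b)).sum).sum := by
  intro x
  rw [← sum_map_sum_comm cols (List.range nb) fun c b => evalT x (c.smallB nb b),
    ← sum_map_sum_comm cols (List.range nb) fun c b => evalT x (c.largeB nb b)]
  apply List.sum_le_sum
  intro c hc
  rw [List.all_eq_true] at hvalid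
  exact FCol.sum_small_le_large c (hvalid c hc) hnb w v

/-- A factored column on a k-petal sunflower group (soundness of the base supplied as a hypothesis). [folklore] -/
structure FColK where
  /-- the k-petal base group -/
  base : SFKSpec
  /-- extra multiplier: a product of linear forms -/
  factors : List (List ℕ)

/-- The small-side terms of a factored k-petal column in bucket `b`. [folklore] -/
def FColK.smallB (nb b : ℕ) (c : FColK) : List Term :=
  (mulFactors (normalize (c.base.rows.flatMap fun r => pairTerms r.e1 r.e2 r.mult r.wt)) c.factors).filter fun t => bucket nb t == b

/-- The large-side terms of a factored k-petal column in bucket `b`. [folklore] -/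
def FColK.largeB (nb b : ℕ) (c : FColK) : List Term :=
  (mulFactors (normalize (c.base.rows.flatMap fun r => pairTerms r.e3 r.e4 r.mult r.wt)) c.factors).filter fun t => bucket nb t == b

/-- **Factored k-petal columns hold in sum over buckets**, given the base soundness. [folklore] -/
theorem FColK.sum_all (cols : List FColK) (hvalid : (cols.all fun c => c.base.valid) = true)
    (hS : cols ≠ [] → ∀ s : SFKSpec, s.valid = true → GroupHolds s.rows) {nb : ℕ} (hnb : 0 < nb)
    (w : Sym2 (Fin n) → unitInterval) (v : Fin 5 → Fin n) :
    let x : ℕ → ℝ := fun m => (prodBernoulli w).real (Cell v m)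
    ((List.range nb).map fun b => (cols.map fun c => evalT x (c.smallB nb b)).sum).sum ≤
      ((List.range nb).map fun b => (cols.map fun c => evalT x (c.largeB nb b)).sum).sum := by
  intro x
  have hx : ∀ i, 0 ≤ x i := fun _ => measureReal_nonneg
  rw [← sum_map_sum_comm cols (List.range nb) fun c b => evalT x (c.smallB nb b),
    ← sum_map_sum_comm cols (List.range nb) fun c b => evalT x (c.largeB nb b)]
  apply List.sum_le_sum
  intro c hc
  rw [List.all_eq_true] at hvalid
  have hne : cols ≠ [] := List.ne_nil_of_mem hc
  have hB := hS hne c.base (hvalid c hc) n w v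
  have hSm : ((List.range nb).map fun b => evalT x (c.smallB nb b)).sum =
      (c.base.rows.map fun r => (r.wt : ℝ) * evalM x r.mult * (linEval x r.e1 * linEval x r.e2)).sum * evalF x c.factors := by
    have h := evalT_eq_sum_buckets x hnb (mulFactors (normalize (c.base.rows.flatMap fun r => pairTerms r.e1 r.e2 r.mult r.wt)) c.factors)
    simp only [FColK.smallB]
    rw [← h, evalT_mulFactors, evalT_normalize, evalT_flatMap]
    simp only [evalT_pairTerms]
  have hLg : ((List.range nb).map fun b => evalT x (c.largeB nb b)).sum =
      (c.base.rows.map fun r => (r.wt : ℝ) * evalM x r.mult * (linEval x r.e3 * linEval x r.e4)).sum * evalF x c.factors := by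
    have h := evalT_eq_sum_buckets x hnb (mulFactors (normalize (c.base.rows.flatMap fun r => pairTerms r.e3 r.e4 r.mult r.wt)) c.factors)
    simp only [FColK.largeB]
    rw [← h, evalT_mulFactors, evalT_normalize, evalT_flatMap]
    simp only [evalT_pairTerms]
  rw [hSm, hLg]
  exact mul_le_mul_of_nonneg_right hB (evalF_nonneg x hx _)

/-! ## Factored multiplier `M₀` (products of masses) -/

/-- Value of a factored multiplier list `Σ w · Π linEval(factors)`. [folklore] -/
def m0valF (x : ℕ → ℝ) (M0F : List (List (List ℕ) × ℕ)) : ℝ := (M0F.map fun p => (p.2 : ℝ) * evalF x p.1).sum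

/-- The terms of `M₀ᶠ · (part of F with sign b)`: for each factored monomial, the target pairs times the weight, multiplied out by
the factors (normalising as we go). [folklore] -/
def qTermsF (M0F : List (List (List ℕ) × ℕ)) (ts : List QTerm) (b : Bool) : List Term :=
  M0F.flatMap fun p => (ts.filter fun t => t.pos == b).flatMap fun t => mulFactors (pairTerms t.e1 t.e2 [] (p.2 * t.coef)) p.1

/-- Value of the factored target terms. [folklore] -/
theorem evalT_qTermsF (x : ℕ → ℝ) (M0F : List (List (List ℕ) × ℕ)) (ts : List QTerm) (b : Bool) :
    evalT x (qTermsF M0F ts b) = m0valF x M0F * ((ts.filter fun t => t.pos == b).map fun t => t.val x).sum := by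
  unfold qTermsF m0valF
  rw [evalT_flatMap]
  induction M0F with
  | nil => simp
  | cons p M0 ih =>
    rw [List.map_cons, List.sum_cons, ih, List.map_cons, List.sum_cons, add_mul]
    congr 1
    rw [evalT_flatMap]
    simp only [evalT_mulFactors, evalT_pairTerms, QTerm.val, Nat.cast_mul]
    rw [← List.sum_map_mul_left]
    congr 1
    refine List.map_congr_left fun t _ => ?_
    simp only [evalM, List.map_nil, List.prod_nil]
    ring

/-- `M₀ᶠ` is nonnegative at nonnegative points. [folklore] -/
theorem m0valF_nonneg (x : ℕ → ℝ) (hx : ∀ i, 0 ≤ x i) (M0F : List (List (List ℕ) × ℕ)) : 0 ≤ m0valF x M0F :=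
  List.sum_nonneg fun y hy => by
    obtain ⟨p, _, rfl⟩ := List.mem_map.1 hy
    exact mul_nonneg (Nat.cast_nonneg _) (evalF_nonneg x hx _)

/-- **Positivity of `M₀ᶠ`**: some factored monomial has positive weight and every factor of it contains a cell positive at `x`. [folklore] -/
theorem m0valF_pos (x : ℕ → ℝ) (hx : ∀ i, 0 ≤ x i) (M0F : List (List (List ℕ) × ℕ)) {p : List (List ℕ) × ℕ} (hp : p ∈ M0F)
    (hw : 0 < p.2) (hfac : ∀ f ∈ p.1, ∃ c ∈ f, 0 < x c) : 0 < m0valF x M0F := by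
  have hterm : 0 < (p.2 : ℝ) * evalF x p.1 := by
    refine mul_pos (by exact_mod_cast hw) ?_
    unfold evalF
    exact List.prod_pos fun y hy => by
      obtain ⟨f, hf, rfl⟩ := List.mem_map.1 hy
      obtain ⟨c, hc, hcpos⟩ := hfac f hf
      unfold linEval
      obtain ⟨l₁, l₂, rfl⟩ := List.append_of_mem hc
      rw [List.map_append, List.map_cons, List.sum_append, List.sum_cons]
      have h1 : 0 ≤ (l₁.map x).sum := List.sum_nonneg fun b hb => by obtain ⟨i, _, rfl⟩ := List.mem_map.1 hb; exact hx i
      have h2 : 0 ≤ (l₂.map x).sum := List.sum_nonneg fun b hb => by obtain ⟨i, _, rfl⟩ := List.mem_map.1 hb; exact hx i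
      linarith
  have hmem : (p.2 : ℝ) * evalF x p.1 ∈ M0F.map fun q => (q.2 : ℝ) * evalF x q.1 := List.mem_map.2 ⟨p, hp, rfl⟩
  unfold m0valF
  obtain ⟨l₁, l₂, hl⟩ := List.append_of_mem hmem
  rw [hl, List.sum_append, List.sum_cons]
  have hn : ∀ l : List (List (List ℕ) × ℕ), 0 ≤ ((l.map fun q => (q.2 : ℝ) * evalF x q.1)).sum := fun l => m0valF_nonneg x hx l
  have h1 : 0 ≤ l₁.sum := by
    have : ∀ y ∈ l₁, 0 ≤ y := fun y hy => by
      have : y ∈ M0F.map fun q => (q.2 : ℝ) * evalF x q.1 := by rw [hl]; exact List.mem_append_left _ hy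
      obtain ⟨q, _, rfl⟩ := List.mem_map.1 this
      exact mul_nonneg (Nat.cast_nonneg _) (evalF_nonneg x hx _)
    exact List.sum_nonneg this
  have h2 : 0 ≤ l₂.sum := by
    have : ∀ y ∈ l₂, 0 ≤ y := fun y hy => by
      have : y ∈ M0F.map fun q => (q.2 : ℝ) * evalF x q.1 := by rw [hl]; exact List.mem_append_right _ (List.mem_cons_of_mem _ hy)
      obtain ⟨q, _, rfl⟩ := List.mem_map.1 this
      exact mul_nonneg (Nat.cast_nonneg _) (evalF_nonneg x hx _)
    exact List.sum_nonneg this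
  linarith

/-! ## Hypothesis rows with factored multipliers -/

/-- A hypothesis row `w · m · Πf · (μ(D_hi) − μ(D_lo)) ≥ 0` with a factored multiplier. [folklore] -/
structure FLin where
  /-- the hypothesis pair `(lo, hi)` -/
  hyp : Fin 5 × Fin 5
  /-- cell-monomial part of the multiplier -/
  mult : List ℕ
  /-- factored part of the multiplier -/
  factors : List (List ℕ)
  /-- weight -/
  wt : ℕ

/-- The low-side terms in bucket `b` (they join the minus list). [folklore] -/
def FLin.loB (nb b : ℕ) (h : FLin) : List Term :=
  (mulFactors (linTerms (cellsOf (fD h.hyp.1)) h.mult h.wt) h.factors).filter fun t => bucket nb t == b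

/-- The high-side terms in bucket `b` (they join the plus list). [folklore] -/
def FLin.hiB (nb b : ℕ) (h : FLin) : List Term :=
  (mulFactors (linTerms (cellsOf (fD h.hyp.2)) h.mult h.wt) h.factors).filter fun t => bucket nb t == b

/-- **Factored hypothesis rows hold in sum over buckets** when their hypotheses hold. [folklore] -/
theorem FLin.sum_all (hs : List FLin) {nb : ℕ} (hnb : 0 < nb) (w : Sym2 (Fin n) → unitInterval) (v : Fin 5 → Fin n)
    (hh : ∀ h ∈ hs, (prodBernoulli w).real ((fD h.hyp.1).set v) ≤ (prodBernoulli w).real ((fD h.hyp.2).set v)) :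
    let x : ℕ → ℝ := fun m => (prodBernoulli w).real (Cell v m)
    ((List.range nb).map fun b => (hs.map fun h => evalT x (h.loB nb b)).sum).sum ≤
      ((List.range nb).map fun b => (hs.map fun h => evalT x (h.hiB nb b)).sum).sum := by
  intro x
  have hx : ∀ i, 0 ≤ x i := fun _ => measureReal_nonneg
  rw [← sum_map_sum_comm hs (List.range nb) fun h b => evalT x (h.loB nb b),
    ← sum_map_sum_comm hs (List.range nb) fun h b => evalT x (h.hiB nb b)]
  apply List.sum_le_sum
  intro h hmem
  have eLo : ((List.range nb).map fun b => evalT x (h.loB nb b)).sum = (h.wt : ℝ) * evalM x h.mult * linEval x (cellsOf (fD h.hyp.1)) * evalF x h.factors := by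
    have e := evalT_eq_sum_buckets x hnb (mulFactors (linTerms (cellsOf (fD h.hyp.1)) h.mult h.wt) h.factors)
    simp only [FLin.loB]
    rw [← e, evalT_mulFactors, evalT_linTerms]
  have eHi : ((List.range nb).map fun b => evalT x (h.hiB nb b)).sum = (h.wt : ℝ) * evalM x h.mult * linEval x (cellsOf (fD h.hyp.2)) * evalF x h.factors := by
    have e := evalT_eq_sum_buckets x hnb (mulFactors (linTerms (cellsOf (fD h.hyp.2)) h.mult h.wt) h.factors)
    simp only [FLin.hiB]
    rw [← e, evalT_mulFactors, evalT_linTerms]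
  rw [eLo, eHi]
  have hle : linEval x (cellsOf (fD h.hyp.1)) ≤ linEval x (cellsOf (fD h.hyp.2)) := by
    simpa only [x, ← measureReal_set_eq_linEval] using hh h hmem
  have hw0 : 0 ≤ (h.wt : ℝ) * evalM x h.mult := mul_nonneg (Nat.cast_nonneg _) (evalM_nonneg x hx _)
  have := mul_le_mul_of_nonneg_left hle hw0
  exact mul_le_mul_of_nonneg_right this (evalF_nonneg x hx _)

end CondCert

end Summit.CriticalPhenomena.PercolationContinuityZ3.Theorems

end
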